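import Summits.CriticalPhenomena.PercolationContinuityZ3.Theorems.Transplant.FKConjectureCDefs
import Mathlib.Combinatorics.Matroid.Map
import HarnessLib

/-!
# Conjecture C — TRANSPORT along a bijection of the ground set: `FK.ConjectureC → FK.ConjectureCOn α` for every finite type `α`

Def-free helper file (`--supports stmt-CriticalPhenomena-4575 --as helper`), stmt lineage (stmt-g40); builds on p205010 (kernel theorem, internal audit signed;
external expert review pending) — nothing here uses p205010.  No definitions, no sorries, standard axioms; nothing asserted about the node `FK.ConjectureC`.

«FKConjectureCDefs» (p652189) states the node as `∀ n, ConjectureCOn (Fin n)`.  Every statement about a matroid on another finite ground type `α` (edge sets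
`Finset (Sym2 V)` for the bridge to 77a, `Fin k × Fin 2`, …) needs the relabelling invariance of the three ingredients, which this file proves for an arbitrary
`e : α ≃ β`: the nullity (`corank_mapEquiv`: `corank (M.mapEquiv e) (F.map e) = corank M F`, Mathlib `Matroid.mapEquiv` / `Matroid.eRk_map`), the two levels and
the kernel (`alignedNullLevel_mapEquiv`, `twistedNullLevel_mapEquiv`, `conjCKernel_mapEquiv`), and the square cone (`inPairSquareCone_comp_equiv`: a pair square
certificate is pushed forward square by square, `insert (e a) (x.map e) = (insert a x).map e`).  Hence `conjectureCOn_of_equiv : ConjectureCOn β → ConjectureCOn α`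
for `α ≃ β` and **`conjectureCOn_of_conjectureC : ConjectureC → ConjectureCOn α`** (`Fintype.equivFin`).
[cite: Oxley2011, §1.3 (isomorphism invariance of rank and nullity)] [cite: Panzer2022, §2.3 (corank)]
-/

noncomputable section

namespace Summit.CriticalPhenomena.PercolationContinuityZ3.Theorems

namespace FK

open Literature.Combinatorics.Matroid
open scoped Classical

variable {α β : Type*}

/-! ### Nullity, levels and kernel are invariant under relabelling -/

/-- The nullity of a finite set is invariant under relabelling the ground set along a bijection (`Matroid.mapEquiv`). [cite: Oxley2011, §1.3] -/
theorem corank_mapEquiv (M : Matroid α) (e : α ≃ β) (F : Finset α) :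
    corank (M.mapEquiv e) (F.map e.toEmbedding) = corank M F := by
  unfold corank
  rw [Finset.card_map]
  congr 2
  rw [Finset.coe_map, Matroid.mapEquiv_eq_map]
  have h1 : (M.map e e.injective.injOn).eRk (⇑e.toEmbedding '' (F : Set α)) =
      (M.map e e.injective.injOn).eRk (e '' ((F : Set α) ∩ M.E)) := by
    rw [← Matroid.eRk_inter_ground, Matroid.map_ground, Equiv.coe_toEmbedding, ← Set.image_inter e.injective]
  rw [h1, Matroid.eRk_map _ _ Set.inter_subset_right, Matroid.eRk_inter_ground]

/-- Complement commutes with relabelling along a bijection. [folklore] -/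
theorem compl_map_equiv [Fintype α] [Fintype β] (e : α ≃ β) (x : Finset α) :
    (x.map e.toEmbedding)ᶜ = xᶜ.map e.toEmbedding := by
  ext b
  simp only [Finset.mem_compl, Finset.mem_map_equiv]

/-- The aligned level is invariant under relabelling. [folklore] -/
theorem alignedNullLevel_mapEquiv [Fintype α] [Fintype β] (M : Matroid α) (e : α ≃ β) (x y : Finset α) :
    alignedNullLevel (M.mapEquiv e) (x.map e.toEmbedding) (y.map e.toEmbedding) = alignedNullLevel M x y := by
  unfold alignedNullLevel
  rw [compl_map_equiv, compl_map_equiv, ← Finset.map_inter, ← Finset.map_inter, corank_mapEquiv, corank_mapEquiv]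

/-- The twisted level is invariant under relabelling. [folklore] -/
theorem twistedNullLevel_mapEquiv (M : Matroid α) (e : α ≃ β) (x y : Finset α) :
    twistedNullLevel (M.mapEquiv e) (x.map e.toEmbedding) (y.map e.toEmbedding) = twistedNullLevel M x y := by
  unfold twistedNullLevel
  rw [← Finset.map_sdiff, ← Finset.map_sdiff, corank_mapEquiv, corank_mapEquiv]

/-- The kernel of Conjecture C is invariant under relabelling. [folklore] -/
theorem conjCKernel_mapEquiv [Fintype α] [Fintype β] (M : Matroid α) (e : α ≃ β) (J : ℕ) (x y : Finset α) :
    conjCKernel (M.mapEquiv e) J (x.map e.toEmbedding) (y.map e.toEmbedding) = conjCKernel M J x y := by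
  unfold conjCKernel
  rw [alignedNullLevel_mapEquiv, twistedNullLevel_mapEquiv]

/-! ### The square cone is invariant under relabelling -/

/-- **Push-forward of a pair square certificate along a bijection.**  If `K` on the pair space of `α` lies in the square cone, then so does the kernel
`(x', y') ↦ K (x'.map e⁻¹) (y'.map e⁻¹)` on the pair space of `β` (each elementary square at `(x, y; a, b)` goes to the square at `(x.map e, y.map e; e a, e b)`).
[cite: Wagner2006, Thm. 5.8(d), §5.3] -/
theorem inPairSquareCone_comp_equiv [Fintype α] [Fintype β] (e : α ≃ β) {K : Finset α → Finset α → ℝ} (hK : InPairSquareCone K) :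
    InPairSquareCone (fun x' y' : Finset β => K (x'.map e.symm.toEmbedding) (y'.map e.symm.toEmbedding)) := by
  obtain ⟨c, hc, hcert⟩ := hK
  set fc : Finset α ≃ Finset β := e.finsetCongr with hfc
  have hfc_apply : ∀ x : Finset α, fc x = x.map e.toEmbedding := fun x => Equiv.finsetCongr_apply e x
  have hfc_symm : ∀ x' : Finset β, x'.map e.symm.toEmbedding = fc.symm x' := fun x' => by
    rw [hfc, Equiv.finsetCongr_symm, Equiv.finsetCongr_apply]
  refine ⟨fun x' y' a' b' => c (fc.symm x') (fc.symm y') (e.symm a') (e.symm b'), fun _ _ _ _ => hc _ _ _ _, fun Φ' => ?_⟩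
  have key := hcert (fun x y => Φ' (fc x) (fc y))
  -- left-hand side, reindexed along `fc`
  have hL : ∑ x' : Finset β, ∑ y' : Finset β, K (x'.map e.symm.toEmbedding) (y'.map e.symm.toEmbedding) * Φ' x' y' =
      ∑ x : Finset α, ∑ y : Finset α, K x y * Φ' (fc x) (fc y) := by
    rw [← Equiv.sum_comp fc]
    refine Finset.sum_congr rfl fun x _ => ?_
    rw [← Equiv.sum_comp fc]
    refine Finset.sum_congr rfl fun y _ => ?_
    rw [hfc_symm, hfc_symm, Equiv.symm_apply_apply, Equiv.symm_apply_apply]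
  -- right-hand side, reindexed along `fc`, `fc`, `e`, `e`
  have hins : ∀ (a : α) (x : Finset α), insert (e a) (fc x) = fc (insert a x) := fun a x => by
    rw [hfc_apply, hfc_apply, Finset.map_insert, Equiv.coe_toEmbedding]
  have hR : ∑ x' : Finset β, ∑ y' : Finset β, ∑ a' : β, ∑ b' : β,
      c (fc.symm x') (fc.symm y') (e.symm a') (e.symm b') *
        (Φ' x' y' + Φ' (insert a' x') (insert b' y') - Φ' (insert a' x') y' - Φ' x' (insert b' y')) =
      ∑ x : Finset α, ∑ y : Finset α, ∑ a : α, ∑ b : α,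
        c x y a b * (Φ' (fc x) (fc y) + Φ' (fc (insert a x)) (fc (insert b y)) - Φ' (fc (insert a x)) (fc y) - Φ' (fc x) (fc (insert b y))) := by
    rw [← Equiv.sum_comp fc]
    refine Finset.sum_congr rfl fun x _ => ?_
    rw [← Equiv.sum_comp fc]
    refine Finset.sum_congr rfl fun y _ => ?_
    rw [← Equiv.sum_comp e]
    refine Finset.sum_congr rfl fun a _ => ?_
    rw [← Equiv.sum_comp e]
    refine Finset.sum_congr rfl fun b _ => ?_
    rw [Equiv.symm_apply_apply, Equiv.symm_apply_apply, Equiv.symm_apply_apply, Equiv.symm_apply_apply, hins, hins]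
  rw [hL, hR]
  exact key

/-- **Conjecture C on `β` transports to every `α ≃ β`** (relabel the matroid by `Matroid.mapEquiv`, the kernel by `conjCKernel_mapEquiv`, the certificate by
`inPairSquareCone_comp_equiv`). [cite: Oxley2011, §1.3] -/
theorem conjectureCOn_of_equiv [Fintype α] [Fintype β] (e : α ≃ β) (h : ConjectureCOn β) : ConjectureCOn α := by
  intro M J
  have h1 := inPairSquareCone_comp_equiv e.symm (h (M.mapEquiv e) J)
  have h2 : (fun x' y' : Finset α => conjCKernel (M.mapEquiv e) J (x'.map e.symm.symm.toEmbedding) (y'.map e.symm.symm.toEmbedding)) =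
      conjCKernel M J := by
    funext x y
    rw [Equiv.symm_symm, conjCKernel_mapEquiv]
  rwa [h2] at h1

/-- **`ConjectureC` gives Conjecture C on EVERY finite ground type** (along `Fintype.equivFin`).  The node itself is NOT asserted; this is the transport only.
[cite: Oxley2011, §1.3] -/
theorem conjectureCOn_of_conjectureC [Fintype α] (h : ConjectureC) : ConjectureCOn α :=
  conjectureCOn_of_equiv (Fintype.equivFin α) (h (Fintype.card α))

end FK

end Summit.CriticalPhenomena.PercolationContinuityZ3.Theorems

end
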